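import Summits.QuantumFields.YangMills.Theorems.FluctuationComparisonRegPrIntLRegArgminFlat
import Literature.MathematicalPhysics.QuantumFieldTheory.Balaban1983to89.B12ContinuousTransportInvarianceOn
import HarnessLib

/-!
# ORB̄ (the CLOSED-WINDOW «achievers on one residual orbit» letter of ✓`gapFlatAt_of_orbBar_of_morseBott`) FROM PRINT'S PROP. 7 CLAUSE 1, THE CLOSED-WINDOW REG-ARGMIN̄
# AND THE CLOSEDNESS OF THE GOOD FIBRE — and outright over the flat datum (crux `FluctuationComparisonRegPrIntL`, stmt-QuantumFields-20520; registry v11.4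
# `Cruxes/FluctuationComparisonRegPrIntL/Lines/semiclassical_s2beta.lean` 3732b7df, organ GAP♯∘ l.768 read as GAP♭ per datum — px17 g14 FINDING a52e0050, CERT 603780ac, ✓p789040)

Cell `ym3-torus` (YM ladder rung R3 = continuum `SU(2)` Yang–Mills on the three-torus — a RUNG, NOT d = 4, NOT infinite volume, NOT a mass gap, NOT Clay); width seat `ym3-torus-px17`
(gen 14), ORB side; `--supports stmt-QuantumFields-20520 --as helper`, count-neutral, definition-free, default heartbeats.

WHAT.  ✓p789040 reduced GAP♭(V,U₀) (= GAP♯∘ as consumed) to MB(V,U₀) and ORB̄(V,U₀) := «every `U ∈ closure (fibre V ∩ histGood)` with `A U ≤ min₍₆₎` is a residual translate of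
`U₀`».  This file is the closed-window twin of ✓p784065 §1: ★★`orbBar_of_atMostOneCriticalOrbit` — ORB̄(V,U₀) ⟸ {[Balaban1985Variational] Prop. 7 cl.1 at the carrier
(`AtMostOneCriticalOrbit ε₀ V`), `U₀` a (6)-regular (6)-minimiser, REG-ARGMIN̄(V) := «closed-window achievers are (6)-regular», CL(V) := `closure (fibre V ∩ histGood) ⊆ fibre V`}
— a closed-window achiever that is (6)-regular and in the fibre lies in (6) with `A ≤ min ≤ A`, so it minimises over (6); Prop. 7 puts it on `U₀`'s sheet-orbit, and print's sheet
`u↓ = 1` is residual.  CL is displayed because the family's descent `descendTo` (iterated exp-mean-log averages) is continuous only on the small-diameter domain (lit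
`BlockAveragingExpMeanLogContinuous`); on good histories it holds, but that is a separate (kinematic) lemma.  ★★`orbBar_one_of_prop7At` — over the FLAT datum REG-ARGMIN̄ is free
(a closed-window achiever has `A ≤ minActionRegPr … 1 = 0`, hence is flat, hence (6)-regular: ✓p785685 `regPr_of_flat`), so ORB̄(1, 1) ⟸ {Prop. 7 cl.1, CL(1)} at every depth.

HONEST (CREDIT NOTHING): doors; Prop. 7 is a HYPOTHESIS schema; REG-ARGMIN̄ at depth `(1−1∕m)K` is the organ's unprinted qualitative content (UV3-NODE §37); CL is a displayed kinematic
letter; GAP♭∕GAP♯∘∕EXW∘∕S2β∕20520, EX (19200) NOT proved; registry №36 untouched; rung R3 = SU(2) YM₃ on T³ — NOT d = 4, NOT infinite volume, NOT a mass gap, NOT Clay.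
Sorry-free, axioms standard.

References: T. Bałaban, CMP **102** (1985) 277–309 [Balaban1985Variational] ((2)–(6) p.278, Prop. 7 p.299); CMP **109** (1987) 249–301 [Balaban1987RG1] ((0.4) p.253).
-/

set_option autoImplicit false

noncomputable section

namespace Summit.QuantumFields.YangMills.Theorems.FluctuationComparisonRegPrIntLOrbBarOfRegArgminBar

open Set
open Literature.MathematicalPhysics.QuantumFieldTheory.Balaban1983to89
open Literature.MathematicalPhysics.QuantumFieldTheory.Balaban1983to89.T3ContinuumYM3Torus
open Literature.MathematicalPhysics.QuantumFieldTheory.Balaban1983to89.T3UnitLawDensityEML (ℰp)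
open Literature.MathematicalPhysics.QuantumFieldTheory.Balaban1983to89.T3UnitScaleTilt
open Literature.MathematicalPhysics.QuantumFieldTheory.Balaban1983to89.T3TiltDescent
open Literature.MathematicalPhysics.QuantumFieldTheory.Balaban1983to89.T3ConstrainedMinimiser (fibre)
open Literature.MathematicalPhysics.QuantumFieldTheory.Balaban1983to89.T3PrintedRegularMinimiser
open Literature.MathematicalPhysics.QuantumFieldTheory.Balaban1983to89.T3Thm1Carrier (varProblem3)
open Literature.MathematicalPhysics.QuantumFieldTheory.Balaban1983to89.T3Thm1UniquenessSchema (Prop7AtMostOneCriticalOrbitAt)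
open Literature.MathematicalPhysics.QuantumFieldTheory.Balaban1983to89.T3DescentFibreTower
open Literature.MathematicalPhysics.QuantumFieldTheory.Balaban1983to89.Missing
open Literature.MathematicalPhysics.QuantumFieldTheory.Balaban1983to89.T4Continuum
open Summit.QuantumFields.YangMills.Theorems.FluctuationComparisonRegPrIntLS2BetaResidualGauge
open Summit.QuantumFields.YangMills.Theorems.FluctuationComparisonRegPrIntLRegArgminFlat

section Door

variable (F : T3Family) {J K : ℕ} (hJK : J ≤ K) {γ b₀ p₀ ε₀ : ℝ}

/-- ★★ **ORB̄(V,U₀) ⟸ PROP. 7 CL.1 ∧ REG-ARGMIN̄(V) ∧ CL(V)**, for a (6)-regular (6)-minimiser `U₀`: every closed-window achiever (`U ∈ closure (fibre V ∩ histGood)`, `A U ≤ min₍₆₎`) is a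
residual translate of `U₀`. [cite: Balaban1985Variational, Prop. 7 p.299] -/
theorem orbBar_of_atMostOneCriticalOrbit (hε₀ : 0 < ε₀)
    {V : GaugeField (F.P J) 0 (Matrix.specialUnitaryGroup (Fin 2) ℂ)} (h7 : (varProblem3 F J K hJK).AtMostOneCriticalOrbit ε₀ V)
    {U₀ : GaugeField (F.P K) 0 (Matrix.specialUnitaryGroup (Fin 2) ℂ)} (hU₀ : U₀ ∈ regFibrePr F J K hJK ε₀ V)
    (hU₀min : wilsonAction4 U₀ = minActionRegPr F J K hJK ε₀ V)
    (hRA : ∀ U ∈ closure (fibre F ℰp J K hJK V ∩ histGood F ℰp (θBal F.L γ b₀ p₀) K J),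
      wilsonAction4 U ≤ minActionRegPr F J K hJK ε₀ V → RegPr F J K ε₀ U)
    (hCL : closure (fibre F ℰp J K hJK V ∩ histGood F ℰp (θBal F.L γ b₀ p₀) K J) ⊆ fibre F ℰp J K hJK V) :
    ∀ U ∈ closure (fibre F ℰp J K hJK V ∩ histGood F ℰp (θBal F.L γ b₀ p₀) K J),
      wilsonAction4 U ≤ minActionRegPr F J K hJK ε₀ V →
        ∃ w : Site (F.P K) 0 → Matrix.specialUnitaryGroup (Fin 2) ℂ,
          (∀ U' : GaugeField (F.P K) 0 (Matrix.specialUnitaryGroup (Fin 2) ℂ),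
              descendTo F ℰp J K hJK (GaugeField.gaugeAct w U') = descendTo F ℰp J K hJK U') ∧
            U = GaugeField.gaugeAct w U₀ := by
  intro U hUcl hUle
  have hUreg : U ∈ regFibrePr F J K hJK ε₀ V := (mem_regFibrePr_iff F).mpr ⟨hCL hUcl, hRA U hUcl hUle⟩
  have hUeq : wilsonAction4 U = minActionRegPr F J K hJK ε₀ V := le_antisymm hUle (minActionRegPr_le F hUreg)
  have hminU : IsMinOn (fun W : GaugeField (F.P K) 0 (Matrix.specialUnitaryGroup (Fin 2) ℂ) => wilsonAction4 W) (regFibrePr F J K hJK ε₀ V) U :=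
    fun W hW => by show wilsonAction4 U ≤ wilsonAction4 W; rw [hUeq]; exact minActionRegPr_le F hW
  have hmin₀ : IsMinOn (fun W : GaugeField (F.P K) 0 (Matrix.specialUnitaryGroup (Fin 2) ℂ) => wilsonAction4 W) (regFibrePr F J K hJK ε₀ V) U₀ :=
    fun W hW => by show wilsonAction4 U₀ ≤ wilsonAction4 W; rw [hU₀min]; exact minActionRegPr_le F hW
  have hreg₀ : RegPr F J K ε₀ U₀ := ((mem_regFibrePr_iff F).mp hU₀).2
  obtain ⟨u, hu, hUu⟩ := h7 U₀ U hreg₀ ((mem_regFibrePr_iff F).mp hU₀).1 ⟨ε₀, hε₀, hU₀, hmin₀⟩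
    (hRA U hUcl hUle) (hCL hUcl) ⟨ε₀, hε₀, hUreg, hminU⟩
  exact ⟨u, residual_of_descTransf_eq_one F hJK hu, hUu⟩

/-- ★★ **ORB̄ OVER THE FLAT DATUM AT EVERY DEPTH ⟸ PROP. 7 CL.1 ∧ CL(1)** (`0 < ε₀ ≤ a₀`, `0 < B₃`, `F.L = L`, `J < K`): REG-ARGMIN̄(1) is free — a closed-window achiever over
`V ≡ 1` has `A ≤ minActionRegPr … 1 = 0`, so it is flat (zero action on `SU(2)`), so it is (6)-regular (✓`regPr_of_flat`); the base point is `1` itself. [cite: Balaban1985Variational, Prop. 7 p.299 and (6) p.278] -/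
theorem orbBar_one_of_prop7At {L : ℕ} {a₀ B₃ : ℝ} (h7 : Prop7AtMostOneCriticalOrbitAt L a₀ B₃) (hB₃ : 0 < B₃)
    (hFL : F.L = L) (hlt : J < K) (hε₀ : 0 < ε₀) (hε₀a : ε₀ ≤ a₀)
    (hCL : closure (fibre F ℰp J K hlt.le 1 ∩ histGood F ℰp (θBal F.L γ b₀ p₀) K J) ⊆ fibre F ℰp J K hlt.le 1) :
    ∀ U ∈ closure (fibre F ℰp J K hlt.le 1 ∩ histGood F ℰp (θBal F.L γ b₀ p₀) K J),
      wilsonAction4 U ≤ minActionRegPr F J K hlt.le ε₀ 1 →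
        ∃ w : Site (F.P K) 0 → Matrix.specialUnitaryGroup (Fin 2) ℂ,
          (∀ U' : GaugeField (F.P K) 0 (Matrix.specialUnitaryGroup (Fin 2) ℂ),
              descendTo F ℰp J K hlt.le (GaugeField.gaugeAct w U') = descendTo F ℰp J K hlt.le U') ∧
            U = GaugeField.gaugeAct w 1 := by
  have hε₁ : 0 < ε₀ / B₃ := div_pos hε₀ hB₃
  have hlo : B₃ * (ε₀ / B₃) ≤ ε₀ := by rw [mul_div_cancel₀ _ hB₃.ne']
  have hA := h7 F hFL J K hlt (ε₀ / B₃) ε₀ hε₁ hlo hε₀a 1 (plaqSmall_one hε₁)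
  refine orbBar_of_atMostOneCriticalOrbit F hlt.le hε₀ hA (one_mem_regFibrePr_one F hε₀) ?_ ?_ hCL
  · rw [minActionRegPr_one F hε₀]
    exact one_mem_argmin_one.wilsonAction4_eq_zero_of_flat' F
  · intro U _ hle
    have hA0 : wilsonAction4 U = 0 := by
      rw [minActionRegPr_one F hε₀] at hle
      exact le_antisymm hle (wilsonAction4_nonneg U)
    exact regPr_of_flat F hε₀ (plaqHol_eq_one_of_wilsonAction4_eq_zero' F U hA0)

end Door

/-! ## §2 (appended) REG-ARGMIN̄ IS FREE AT SHALLOW DEPTH — the closed-window twin of ✓p784065 §2 -/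

section Shallow

open Literature.MathematicalPhysics.QuantumFieldTheory.Balaban1983to89.T3RegularMinimiser (regThreshold)
open Literature.MathematicalPhysics.QuantumFieldTheory.Balaban1983to89.T3AvgDivergenceSplit (regPr_of_plaqSmall)

variable (F : T3Family) {J K : ℕ} {γ b₀ p₀ ε₀ : ℝ}

/-- On the CLOSURE of the good-history event the finest plaquette variables are `≤ θBal(K)` (the `j = 0` clause is `PlaqSmall (θBal … K)`, strict; plaquette variables are continuous,
lit ✓`B12ContinuousTransportInvarianceOn.continuous_plaqHol_SU`∕`continuous_dist1_SU`, so the non-strict bound is closed). [cite: Balaban1985UV3, (7) p.257] -/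
theorem dist1_plaqHol_le_of_mem_closure_histGood (hJK : J ≤ K) {U : GaugeField (F.P K) 0 (Matrix.specialUnitaryGroup (Fin 2) ℂ)}
    (hU : U ∈ closure (histGood F ℰp (θBal F.L γ b₀ p₀) K J)) (p : Plaq (F.P K) 0) :
    dist1 (GaugeField.plaqHol U p) ≤ θBal F.L γ b₀ p₀ K := by
  have hclosed : IsClosed {W : GaugeField (F.P K) 0 (Matrix.specialUnitaryGroup (Fin 2) ℂ) | dist1 (GaugeField.plaqHol W p) ≤ θBal F.L γ b₀ p₀ K} :=
    isClosed_le (B12ContinuousTransportInvarianceOn.continuous_dist1_SU.comp (B12ContinuousTransportInvarianceOn.continuous_plaqHol_SU p))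
      continuous_const
  have hsub : histGood F ℰp (θBal F.L γ b₀ p₀) K J ⊆
      {W : GaugeField (F.P K) 0 (Matrix.specialUnitaryGroup (Fin 2) ℂ) | dist1 (GaugeField.plaqHol W p) ≤ θBal F.L γ b₀ p₀ K} := by
    intro W hW
    have h := hW 0 (by omega)
    rw [Nat.sub_zero] at h
    exact (h p).le
  exact hclosed.closure_subset_iff.mpr hsub hU

/-- **REG-ARGMIN̄ AT SHALLOW DEPTH, FREE**: if `θBal(K) < regThreshold F J K ε₀` and `4θBal(K) < ε₀L^{−3(K−J)}` then EVERY point of the closure of the good fibre is (6)-regular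
(lit ✓`regPr_of_plaqSmall` at a radius strictly between `θBal(K)` and `min (regThreshold) (ε₀L^{−3(K−J)}∕4)`); in particular the `hRA` letter of ★★`orbBar_of_atMostOneCriticalOrbit`
holds with no action condition. [cite: Balaban1985Variational, (2) p.278] -/
theorem regArgminBar_of_lt (hJK : J ≤ K) (V : GaugeField (F.P J) 0 (Matrix.specialUnitaryGroup (Fin 2) ℂ))
    (hθ : θBal F.L γ b₀ p₀ K < regThreshold F J K ε₀) (h4 : 4 * θBal F.L γ b₀ p₀ K < ε₀ * ((F.L : ℝ)⁻¹) ^ (3 * (K - J))) :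
    ∀ U ∈ closure (fibre F ℰp J K hJK V ∩ histGood F ℰp (θBal F.L γ b₀ p₀) K J),
      wilsonAction4 U ≤ minActionRegPr F J K hJK ε₀ V → RegPr F J K ε₀ U := by
  intro U hU _
  have hUg : U ∈ closure (histGood F ℰp (θBal F.L γ b₀ p₀) K J) := closure_mono Set.inter_subset_right hU
  set m : ℝ := min (regThreshold F J K ε₀) (ε₀ * ((F.L : ℝ)⁻¹) ^ (3 * (K - J)) / 4) with hm
  have hθm : θBal F.L γ b₀ p₀ K < m := lt_min hθ (by linarith)
  set δ : ℝ := (θBal F.L γ b₀ p₀ K + m) / 2 with hδ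
  have hθδ : θBal F.L γ b₀ p₀ K < δ := by rw [hδ]; linarith
  have hδm : δ < m := by rw [hδ]; linarith
  have hsmall : PlaqSmall δ U := fun p => (dist1_plaqHol_le_of_mem_closure_histGood F hJK hUg p).trans_lt hθδ
  refine regPr_of_plaqSmall F hsmall (hδm.le.trans (min_le_left _ _)) ?_
  have h4m : m ≤ ε₀ * ((F.L : ℝ)⁻¹) ^ (3 * (K - J)) / 4 := min_le_right _ _
  linarith

end Shallow

end Summit.QuantumFields.YangMills.Theorems.FluctuationComparisonRegPrIntLOrbBarOfRegArgminBar

end
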